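import Summits.ResolutionOfSingularities.ResolutionOfSingularities.Theses.HomologicalConductor
import Summits.ResolutionOfSingularities.ResolutionOfSingularities.Theorems.HomologicalConductorGlobalisationLocEq
import Summits.ResolutionOfSingularities.ResolutionOfSingularities.Theorems.HomologicalConductorGlobalisationChartStep
import Summits.ResolutionOfSingularities.ResolutionOfSingularities.Theorems.HomologicalConductorGlobalisationNrmStep
import Summits.ResolutionOfSingularities.ResolutionOfSingularities.Theorems.HomologicalConductorGlobalisationTowerModel
import Summits.ResolutionOfSingularities.ResolutionOfSingularities.Theorems.HomologicalConductorGlobalisationLurel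
import Literature.AlgebraicGeometry.Resolution.ZariskiPatchingProperModels
import Literature.AlgebraicGeometry.Resolution.ProperModelsPatchingOfResolution
import HarnessLib

/-!
# Route HomologicalConductor — crux `Globalisation` (stmt-ResolutionOfSingularities-16486): the crux
# reduces to, and under its antecedent is equivalent to, two-model patching of proper models

Line `birth_HomologicalConductor` (reshaped v2, "lu-patching cut"), assembly of the five landed stubs
(`stub_locEq`, `stub_chartStep`, `stub_nrmStep`, `stub_towerModel`, `stub_lurel`).

The crux is `Globalisation : ∀ p prime, VT_p → ResolutionInChar p`, where `VT_p` (valuative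
termination of the canonical normalised ca-tower along every valuation ring of every function field
over every field of characteristic `p`; the conclusion of crux `NoZeno`) is the `let`-telescope of
the route file, kept verbatim below. This file proves:

* `lurel_of_valuativeTermination` — **`VT_p` is a (relative) local uniformization theorem**: every
  stage `tower A m` of the canonical tower is the local ring at the centre of `O` of a finitely
  generated model `A ≤ A_m ⊆ O` (`stub_towerModel`: `ca(T_m)` is a finitely generated ideal of a
  Noetherian ring, the chart adjoins finitely many `cᵢ/x₀` modulo units, the normalisation of a
  domain essentially of finite type is finite), so a regular stage uniformizes `O` on a finitely
  generated model dominating any prescribed `R ⊆ O` (`stub_lurel`). Output shape: exactly the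
  hypothesis `hLU` of `resolutionInChar_of_properTwoModelPatching_of_relLU`.
* `globalisation_of_twoModelPatching` — **the crux follows from two-model patching of proper
  models** in every prime characteristic (`ProperModel.TwoModelPatching`, Piltant 2013 Prop. 5.1
  with `P = P_reg`; OPEN in dimension `≥ 4`; the open core shared with the cruxes `PatchingRel`
  (stmt-0642) and `Patching` (stmt-0561)): Zariski's programme with proper models
  (`ZariskiPatchingProperModels.lean`) turns `LUrel_p` + patching into `ResolutionInChar p`.
* `resolutionInChar_iff_twoModelPatching_of_valuativeTermination`,
  `globalisation_iff_forall_twoModelPatching` — conversely resolution gives patching back (resolve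
  the join, `ProperModel.twoModelPatching_of_resolutionInChar`), so UNDER ITS OWN ANTECEDENT the crux
  is EQUIVALENT to two-model patching: `Globalisation ↔ ∀ p prime, VT_p → TwoModelPatching p`.
  What the refuted sheaf lever (`Negative.caSheaf_false`) was meant to buy — globalisation by
  canonicity instead of patching — is thereby isolated as the entire residual content of the crux.
* `localUniformizationInChar_of_valuativeTermination` — the absolute named predicate
  `LocalUniformizationInChar p` follows as well (`R = ⊥`).
* `resolutionOfSingularities_of_local_cruxes_of_twoModelPatching` — the route's deciding chain with
  `Globalisation` replaced by two-model patching.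

## References

* O. Zariski, Ann. of Math. 45 (1944), Fundamental Theorem p. 539; O. Zariski, P. Samuel,
  *Commutative Algebra* II, Ch. VI §17. [ZariskiSamuel1960]
* O. Piltant, *An axiomatic version of Zariski's patching theorem*, RACSAM 107 (2013) 91–121,
  Prop. 5.1, Cor. 5.7. [Piltant2013]
* S. B. Iyengar, R. Takahashi, IMRN 2016 (arXiv:1404.1476), Def. 2.1 (the cohomology
  annihilator). [IyengarTakahashi2014]
-/

noncomputable section

-- single-problem summit: the doubled namespace component `ResolutionOfSingularities` is forced
set_option linter.dupNamespace false

namespace Summit.ResolutionOfSingularities.ResolutionOfSingularities.Theorems.HomologicalConductorGlobalisation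

open Literature.AlgebraicGeometry.Resolution
open Summit.ResolutionOfSingularities.ResolutionOfSingularities.Theses.HomologicalConductor (Globalisation)

/-- **Valuative termination of the canonical ca-tower is relative local uniformization** (in
characteristic `p`): if along every valuation ring `O ⊇ A` of every function field `K/k`,
`char k = p`, the canonical tower `T₀ = A_centre, T_(m+1) = (normalisation of T_m[ca(T_m)/x])_centre`
of every affine model `A` reaches a regular local ring, then every finitely generated `R ⊆ O` is
dominated by a finitely generated affine model `R ≤ A' ⊆ O`, `Frac A' = K`, regular at the centre
of `O` — the hypothesis shape `LUrel_p` of the tree's patching theorems. Assembly of the landed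
stubs `stub_locEq`, `stub_chartStep`, `stub_nrmStep` (steps), `stub_towerModel` (every stage is
`locAtCentre A_m O`, `A_m` finitely generated) and `stub_lurel`.
[cite: ZariskiSamuel1960, Ch. VI §17; Piltant2013, Axiom 5] -/
theorem lurel_of_valuativeTermination (p : ℕ)
    (hVT : ∀ (k K : Type) [Field k] [CharP k p] [Field K] [Algebra k K] (O : ValuationSubring K) (A : Subalgebra k K), (∀ c : k, algebraMap k K c ∈ O) → A.FG → IsFractionRing ↥A K → A.toSubring ≤ O.toSubring → let ca : Subalgebra k K → Set K := fun A => {x : K | ∃ hx : x ∈ A, ∃ n : ℕ, ∀ i : ℕ, n ≤ i → ∀ (M N : ModuleCat.{0} ↥A), Module.Finite ↥A M → Module.Finite ↥A N → ∀ e : CategoryTheory.Abelian.Ext.{0} M N i, (⟨x, hx⟩ : ↥A) • e = 0}; let loc : Subalgebra k K → Subalgebra k K := fun A => Algebra.adjoin k {y : K | ∃ a ∈ A, ∃ s ∈ A, s⁻¹ ∈ O ∧ y = a * s⁻¹}; let chart : Subalgebra k K → Subalgebra k K := fun A => Algebra.adjoin k ((A : Set K) ∪ {y : K | ∃ c ∈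 ca A, ∃ x ∈ ca A, x ≠ 0 ∧ (∀ c' ∈ ca A, c' * x⁻¹ ∈ O) ∧ y = c * x⁻¹}); let nrm : Subalgebra k K → Subalgebra k K := fun B => Algebra.adjoin k {y : K | IsIntegral ↥B y}; let tower : Subalgebra k K → ℕ → Subalgebra k K := fun A m => @Nat.rec (fun _ => Subalgebra k K) (loc A) (fun _ B => loc (nrm (chart B))) m; ∃ m : ℕ, IsRegularLocalRing ↥(tower A m)) :
    ∀ (k K : Type) [Field k] [CharP k p] [Field K] [Algebra k K], (⊤ : IntermediateField k K).FG → ∀ O : ValuationSubring K, (∀ c : k, algebraMap k K c ∈ O) → ∀ R : Subalgebra k K, R.FG → R.toSubring ≤ O.toSubring → ∃ (A : Subalgebra k K) (h : A.toSubring ≤ O.toSubring), R ≤ A ∧ A.FG ∧ IsFractionRing ↥A K ∧ IsRegularLocalRing (Localization.AtPrime (Ideal.comap (Subring.inclusion h) (IsLocalRing.maximalIdeal ↥O))) :=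
  stub_lurel (stub_towerModel stub_locEq stub_chartStep stub_nrmStep) p hVT

/-- **Under valuative termination at `p`, resolution in characteristic `p` is EQUIVALENT to
two-model patching of proper models** (`⇒`: resolve the join of the two models,
`ProperModel.twoModelPatching_of_resolutionInChar`; `⇐`: `lurel_of_valuativeTermination` and
Zariski's programme). [cite: Piltant2013, p. 2 and Cor. 5.7] -/
theorem resolutionInChar_iff_twoModelPatching_of_valuativeTermination {p : ℕ}
    (hVT : ∀ (k K : Type) [Field k] [CharP k p] [Field K] [Algebra k K] (O : ValuationSubring K) (A : Subalgebra k K), (∀ c : k, algebraMap k K c ∈ O) → A.FG → IsFractionRing ↥A K → A.toSubring ≤ O.toSubring → let ca : Subalgebra k K → Set K := fun A => {x : K | ∃ hx : x ∈ A, ∃ n : ℕ, ∀ i : ℕ, n ≤ i → ∀ (M N : ModuleCat.{0} ↥A), Module.Finite ↥A M → Module.Finite ↥A N → ∀ e : CategoryTheory.Abelian.Ext.{0} M N i, (⟨x, hx⟩ : ↥A) • e = 0}; let loc : Subalgebra k K → Subalgebra k K := fun A => Algebra.adjoin k {y : K | ∃ a ∈ A, ∃ s ∈ A, s⁻¹ ∈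 O ∧ y = a * s⁻¹}; let chart : Subalgebra k K → Subalgebra k K := fun A => Algebra.adjoin k ((A : Set K) ∪ {y : K | ∃ c ∈ ca A, ∃ x ∈ ca A, x ≠ 0 ∧ (∀ c' ∈ ca A, c' * x⁻¹ ∈ O) ∧ y = c * x⁻¹}); let nrm : Subalgebra k K → Subalgebra k K := fun B => Algebra.adjoin k {y : K | IsIntegral ↥B y}; let tower : Subalgebra k K → ℕ → Subalgebra k K := fun A m => @Nat.rec (fun _ => Subalgebra k K) (loc A) (fun _ B => loc (nrm (chart B))) m; ∃ m : ℕ, IsRegularLocalRing ↥(tower A m)) :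
    ResolutionInChar.{0} p ↔ ProperModel.TwoModelPatching.{0} p :=
  ⟨ProperModel.twoModelPatching_of_resolutionInChar, fun hZ =>
    resolutionInChar_of_properTwoModelPatching_of_relLU hZ (lurel_of_valuativeTermination p hVT)⟩

/-- **The crux `Globalisation` is equivalent to: for every prime `p`, valuative termination of the
canonical ca-tower at `p` implies two-model patching of proper models in characteristic `p`.**
The residual content of the crux beyond the landed local-uniformization stubs is exactly the open
core of Zariski's patching programme (shared with cruxes `PatchingRel` stmt-0642 and `Patching`
stmt-0561); a proof of the crux must either patch two models in dimension `≥ 4` or globalise the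
canonical tower by some other means (the route's sheaf lever `CaSheaf` being refuted,
`Negative.caSheaf_false`). [cite: Piltant2013, Prop. 5.1 and Cor. 5.7] -/
theorem globalisation_iff_forall_twoModelPatching :
    Globalisation ↔ ∀ p : ℕ, p.Prime → (∀ (k K : Type) [Field k] [CharP k p] [Field K] [Algebra k K] (O : ValuationSubring K) (A : Subalgebra k K), (∀ c : k, algebraMap k K c ∈ O) → A.FG → IsFractionRing ↥A K → A.toSubring ≤ O.toSubring → let ca : Subalgebra k K → Set K := fun A => {x : K | ∃ hx : x ∈ A, ∃ n : ℕ, ∀ i : ℕ, n ≤ i → ∀ (M N : ModuleCat.{0} ↥A), Module.Finite ↥A M → Module.Finite ↥A N → ∀ e : CategoryTheory.Abelian.Ext.{0} M N i, (⟨x, hx⟩ : ↥A) • e = 0}; let loc : Subalgebra k K → Subalgebra k K := fun A => Algebra.adjoin k {y : K | ∃ a ∈ A, ∃ s ∈ A, s⁻¹ ∈ O ∧ y = a * s⁻¹}; let chart : Subalgebra k K → Subalgebra k K := fun A => Algebra.adjoin k ((A : Set K) ∪ {y : K | ∃ c ∈ ca A, ∃ x ∈ ca A, x ≠ 0 ∧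 (∀ c' ∈ ca A, c' * x⁻¹ ∈ O) ∧ y = c * x⁻¹}); let nrm : Subalgebra k K → Subalgebra k K := fun B => Algebra.adjoin k {y : K | IsIntegral ↥B y}; let tower : Subalgebra k K → ℕ → Subalgebra k K := fun A m => @Nat.rec (fun _ => Subalgebra k K) (loc A) (fun _ B => loc (nrm (chart B))) m; ∃ m : ℕ, IsRegularLocalRing ↥(tower A m)) → ProperModel.TwoModelPatching.{0} p :=
  ⟨fun hG p hp hVT => (resolutionInChar_iff_twoModelPatching_of_valuativeTermination hVT).mp (hG p hp hVT),
    fun h p hp hVT => (resolutionInChar_iff_twoModelPatching_of_valuativeTermination hVT).mpr (h p hp hVT)⟩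


/-- **The crux `Globalisation` follows from two-model patching of proper models in every prime
characteristic** (Piltant 2013, Prop. 5.1 with `P = P_reg`, OPEN in dimension `≥ 4`): the crux's
antecedent is `LUrel_p` by `lurel_of_valuativeTermination`, and Zariski's programme with proper
models (`resolutionInChar_of_properTwoModelPatching_of_relLU`: compactness of the Zariski–Riemann
space, a finite resolving system, patching two models at a time) returns `ResolutionInChar p`.
A CONDITIONAL closing of the crux: the hypothesis is the conjecture-type statement
`ProperModel.TwoModelPatching`, nobody's theorem in dimension `≥ 4`.
[cite: Piltant2013, Prop. 5.1 and Cor. 5.7] -/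
theorem globalisation_of_twoModelPatching
    (hZ : ∀ p : ℕ, p.Prime → ProperModel.TwoModelPatching.{0} p) : Globalisation :=
  globalisation_iff_forall_twoModelPatching.mpr fun p hp _ => hZ p hp


/-- **Corollary: valuative termination of the canonical ca-tower gives (absolute, weak) local
uniformization in characteristic `p`** — the named predicate `LocalUniformizationInChar` of
`LocalUniformization.lean` (take `R = ⊥` in `lurel_of_valuativeTermination`).
[cite: KnafKuhlmann2009, Section 1 (the predicate); ZariskiSamuel1960, Ch. VI §17] -/
theorem localUniformizationInChar_of_valuativeTermination (p : ℕ)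
    (hVT : ∀ (k K : Type) [Field k] [CharP k p] [Field K] [Algebra k K] (O : ValuationSubring K) (A : Subalgebra k K), (∀ c : k, algebraMap k K c ∈ O) → A.FG → IsFractionRing ↥A K → A.toSubring ≤ O.toSubring → let ca : Subalgebra k K → Set K := fun A => {x : K | ∃ hx : x ∈ A, ∃ n : ℕ, ∀ i : ℕ, n ≤ i → ∀ (M N : ModuleCat.{0} ↥A), Module.Finite ↥A M → Module.Finite ↥A N → ∀ e : CategoryTheory.Abelian.Ext.{0} M N i, (⟨x, hx⟩ : ↥A) • e = 0}; let loc : Subalgebra k K → Subalgebra k K := fun A => Algebra.adjoin k {y : K | ∃ a ∈ A, ∃ s ∈ A, s⁻¹ ∈ O ∧ y = a * s⁻¹}; let chart : Subalgebra k K → Subalgebra k K := fun A => Algebra.adjoin k ((A : Set K) ∪ {y : K | ∃ c ∈ ca A, ∃ x ∈ ca A, x ≠ 0 ∧ (∀ c' ∈ ca A, c' * x⁻¹ ∈ O) ∧ y = c * x⁻¹}); let nrm : Subalgebra k K → Subalgebra k K := fun B => Algebra.adjoin k {y : K | IsIntegral ↥B y}; let tower : Subalgebra k K → ℕ → Subalgebra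 k K := fun A m => @Nat.rec (fun _ => Subalgebra k K) (loc A) (fun _ B => loc (nrm (chart B))) m; ∃ m : ℕ, IsRegularLocalRing ↥(tower A m)) :
    LocalUniformizationInChar.{0} p := by
  intro k K _ _ _ _ hKfg O hO
  have hbot : (⊥ : Subalgebra k K).toSubring ≤ O.toSubring := by
    intro x hx
    obtain ⟨c, rfl⟩ := Algebra.mem_bot.mp (show x ∈ (⊥ : Subalgebra k K) from hx)
    exact hO c
  obtain ⟨A, h, -, hAfg, hAfr, hreg⟩ :=
    lurel_of_valuativeTermination p hVT k K hKfg O hO ⊥ Subalgebra.fg_bot hbot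
  exact ⟨A, h, hAfg, hAfr, hreg⟩

/-- **The route's deciding chain with the crux `Globalisation` discharged modulo patching**:
`Persistence → StrictDrop → NoZeno → (two-model patching of proper models in every prime
characteristic) → ResolutionOfSingularities` — route `HomologicalConductor` reduces to its three
local cruxes plus the open core of Zariski's patching programme. [cite: Piltant2013, Prop. 5.1 and Cor. 5.7] -/
theorem resolutionOfSingularities_of_local_cruxes_of_twoModelPatching
    (hP : Summit.ResolutionOfSingularities.ResolutionOfSingularities.Theses.HomologicalConductor.Persistence)
    (hD : Summit.ResolutionOfSingularities.ResolutionOfSingularities.Theses.HomologicalConductor.StrictDrop)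
    (hT : Summit.ResolutionOfSingularities.ResolutionOfSingularities.Theses.HomologicalConductor.NoZeno)
    (hZ : ∀ p : ℕ, p.Prime → ProperModel.TwoModelPatching.{0} p) : _root_.ResolutionOfSingularities :=
  -- buildfix (bf3-g25, 2026-08-27): route HomologicalConductor re-keyed `closes` to (PersistenceRadical, StrictDrop, NoZenoR,
  -- Globalisation) at 02:33Z; with THIS theorem's (Persistence, StrictDrop, NoZeno) the old deciding chain is inlined verbatim:
  -- valuative termination prime by prime from `NoZeno`, then globalisation by two-model patching; statement unchanged.
  fun p hp => globalisation_of_twoModelPatching hZ p hp (hT hP hD p hp)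

end Summit.ResolutionOfSingularities.ResolutionOfSingularities.Theorems.HomologicalConductorGlobalisation

end
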